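import Summits.BirchSwinnertonDyer.BirchSwinnertonDyer.Theorems.PrintCf2RubinValueTwoKatzMeasureJZeroSeamValuesLabel
import Summits.BirchSwinnertonDyer.BirchSwinnertonDyer.Theorems.PrintCf2RubinValueTwoKatzMeasureJZeroSeamBridgeOfLaneVbarCube
import Summits.BirchSwinnertonDyer.BirchSwinnertonDyer.Theorems.PrintCf2RubinValueTwoKatzMeasureJZeroSeamThetaDatumReading
import Summits.BirchSwinnertonDyer.BirchSwinnertonDyer.Theorems.PrintCf2RubinValueTwoKatzMeasureJZeroSeamCMDatumReading
import HarnessLib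

/-!
# The per-unit VALUES of the `j = 0` seam for ONE reading field, WITH the Tate unit and its point property
# (V1-label = B10f-e (2) [v̄³-twin] ∘ (RP) theta datum ∘ (A) CM datum ∘ V1-label-core; proofs only)

Cell `bsd-print-cf2`, width seat `bsd-line-cf2-p1-w8` g14 (piece [I2] of the SEAM, file 1); `--supports` the crux
stmt-BirchSwinnertonDyer-20368 (helper, Theses-free).  THEOREMS ONLY; no `def`, no named fact, no `sorry`.

`exists_tateUnit_and_forall_readingHom_moment_eq_of_readingField`: on the lane (`K_v ≅ ℚ₂`, uniformiser `u·2 = π₀`, the `ℤ₂`-datum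
`P = exp_W(c·log_W)` of `W = [1,−1,0,−2,−1]`), for ONE finite unramified Galois reading field `E ⊇ e(K(𝔣ψ𝔠r))` with its `α`-datum, a
family of units `β_i ∈ 𝒰_E` reading the theta values `Θ(1; 𝔪v^{m+1}, 𝔞_i)`, the model lattice `L = Ω·ι(𝔪)` (`𝔪 ≤ (π₁³)` — every lane
modulus `𝔪_M`, `M ≥ 3`, `S = ∅` included —, `𝔠r ≤ 𝔪`, `𝔠r ≤ 𝔞_i`),
the ALGEBRAIC theta data `X₀ Y₀ X₁ Y₁ X_c ∈ K(𝔣ψ𝔠r)` (model coordinates of `ξ(Ω)`, `ξ(π₀Ω)`, `ξ(c)`) with their `𝔓`-integrality /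
unit statements (de Shalit II.4.9 (i), HYPOTHESES), clauses (vi)/(vii) of II.1.5 (HYPOTHESES, from the named fact
`DeShalit1987.prop15_grossencharacterReciprocity`), the reading conjugacy `θ ∘ ι̂_v ∘ τ_K = ι_p⁻¹ ∘ ι̂_∞` (Q-θ) and an ideal `𝔟` with
`τ_K⁻¹|_{K(𝔣ψ𝔠r)} = (𝔟, ·)`: **there are the read division points `(x_u, y_u, X_u, Y_u)` and a Tate unit `a ∈ 𝒪_vˣ` with B10a's point
property `P(h([a]ω_{m+1})) = (X_u m, Y_u m)`, such that for every label `i` and every moment `k`: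
`θ(c_{β_i,k}) = θ(a)^{k+1}·ι_p⁻¹(−12(#S_i·E_{k+1}(ψ(𝔟)Ω; L) − E_{k+1}(ψ(𝔟)Ω; L′_i)))` and the Frobenius twin at `ψ(𝔟v)Ω`.**
Proof = `exists_thetaDatum_readingRing` ((RP), cf2-p1-w7) → `exists_cmDatum_readingRing` ((A), cf2-p1-w7) →
`exists_tateUnit_forall_relColemanSeries_eq_subst_subst_of_lane_of_le_span_cube` (B10f-e (2) with the (N1) input at `𝔪 ≤ (π₁³)`, cf2c-w4 / cf2-p1-w5)
→ `forall_readingHom_moment_and_frob_eq_of_bridgeFamily_of_readings` (V1-label-core, this seat g13).  No summit statement is proved; BSD is not proved by any of this.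

## References
* [deShalit1987] E. de Shalit, *Iwasawa theory of elliptic curves with complex multiplication* (1987), II §1.5 (15), II §1.10, II §4.3 (7),
  II §4.4 (iv), II §4.9 (i)(ii) (p. 62–63), II §4.10 (26), II §4.14 (38) (p. 71).
* [SilvermanAEC2009] J. H. Silverman, *The Arithmetic of Elliptic Curves*, 2nd ed. (2009), III.2.3, VII.2.1–VII.2.2.
-/

-- the summit namespace `Summit.BirchSwinnertonDyer.BirchSwinnertonDyer` repeats the problem name by design (D-0017)
set_option linter.dupNamespace false
set_option autoImplicit false

noncomputable section

open scoped Classical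
open scoped NumberField
open PowerSeries IsDedekindDomain IsDedekindDomain.HeightOneSpectrum NumberField ValuativeRel Field PeriodPair
open Literature.NumberTheory.NumberFields Literature.NumberTheory.EllipticCurves Literature.NumberTheory.EllipticCurves.DeShalit1987
  Literature.NumberTheory.ComplexMultiplication.EllipticUnits
open Literature.NumberTheory.GaloisRepresentations Literature.NumberTheory.GaloisRepresentations.IsNonarchimedeanLocalField
  Literature.NumberTheory.GaloisRepresentations.LubinTate Literature.NumberTheory.EllipticCurves.FormalGroupChart Literature.NumberTheory.PAdicHodge
  _root_.WeierstrassCurve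
open Literature.NumberTheory.LFunctions.AbelianDensity (artinSymbol)

namespace Summit.BirchSwinnertonDyer.BirchSwinnertonDyer.Theorems.PrintCf2.KatzMeasureJZeroSeam

attribute [local instance] ltNormUniformSpace ltNormIsUniformAddGroup rk1 nF nE fintypeResidueField

set_option maxHeartbeats 3200000 in
/-- ★★★ **The per-unit values for one reading field, with the Tate unit and its point property** (see the module docstring).
[cite: deShalit1987, II §1.5 (15) (p. 42), II §4.3 (7) (p. 57), II §4.4 (iv), II §4.9 (i)(ii) (p. 62–63), II §4.10 (26) (p. 64), II §4.14 (38) (p. 71)]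
[cite: SilvermanAEC2009, III.2.3, VII.2.2] -/
theorem exists_tateUnit_and_forall_readingHom_moment_eq_of_readingField
    -- the base field, the split prime `v ∣ 2` of degree one
    {K : Type} [Field K] [NumberField K] [IsTotallyComplex K] (v : HeightOneSpectrum (𝓞 K)) [v.asIdeal.LiesOver (ratPlace 2).asIdeal]
    (he : v.asIdeal.ramificationIdx (𝓞 ℚ) = 1) (hf : v.asIdeal.inertiaDeg (𝓞 ℚ) = 1)
    (hq : residueFieldCard (v.adicCompletion K) = 2)
    (h2 : (valuation (v.adicCompletion K)).IsUniformizer ((((2 : ℕ) : 𝒪[v.adicCompletion K]) : v.adicCompletion K)))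
    (u : 𝒪[v.adicCompletion K]ˣ)
    -- the lane's `ℤ₂`-datum of `W = [1,−1,0,−2,−1]`: `P = [c] = exp_W(c·log_W)`, `e(u·2) = c`, `Ê = F_P`, `2 = ϖ·c`
    {c : ℤ_[2]} {P : PowerSeries ℤ_[2]}
    (hPexp : P.map PadicInt.Coe.ringHom = ((⟨1, -1, 0, -2, -1⟩ : WeierstrassCurve ℤ_[2]).map PadicInt.Coe.ringHom).formalExp.subst
      (C (c : ℚ_[2]) * ((⟨1, -1, 0, -2, -1⟩ : WeierstrassCurve ℤ_[2]).map PadicInt.Coe.ringHom).formalLog))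
    (hA : IsLTRing c 2) (hPlt : IsLTSeries c 2 P)
    (heπ : ((integerEquivAdicCompletionIntegers v).trans (padicIntEquivOfDegreeOne K 2 v he hf))
      ((u : 𝒪[v.adicCompletion K]) * ((2 : ℕ) : 𝒪[v.adicCompletion K])) = c)
    (W : WeierstrassCurve ℤ) (hW : W = ⟨1, -1, 0, -2, -1⟩) (hV : (W.map (Int.castRingHom ℤ_[2])).formalGroupLaw = ltF hA hPlt)
    {ϖ : ℤ_[2]} (hp : ((2 : ℕ) : ℤ_[2]) = ϖ * c) (hϖ : IsUnit ϖ)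
    -- the reading field `E ⊇ e(K(𝔣ψ𝔠r))`, finite Galois unramified, with its `α`-datum for the reading modulus `𝔑 ≤ 𝔣ψ·𝔪·(π₁)`
    (E : IntermediateField (v.adicCompletion K) (AlgebraicClosure (v.adicCompletion K)))
    [FiniteDimensional (v.adicCompletion K) E] [Normal (v.adicCompletion K) E] [IsGalois (v.adicCompletion K) E]
    (hEu : E ≤ maxUnramified (v.adicCompletion K)) {σ₀ : absoluteGaloisGroup (v.adicCompletion K)} (hσ₀ : IsAbsArithFrob σ₀)
    [hEll : ∀ m : ℕ, (curveOver (E ⊔ ltField ((u : 𝒪[v.adicCompletion K]) * ((2 : ℕ) : 𝒪[v.adicCompletion K])) m :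
        IntermediateField (v.adicCompletion K) (AlgebraicClosure (v.adicCompletion K)))
      ((W.map (Int.castRingHom ℤ_[2])).map ((LTCoeff.of (v.adicCompletion K)).toRingHom.comp
        ((integerEquivAdicCompletionIntegers v).trans (padicIntEquivOfDegreeOne K 2 v he hf)).symm.toRingHom))).IsElliptic]
    {𝔣ψ 𝔠r : Ideal (𝓞 K)}
    (hEr : ∀ y : AlgebraicClosure K, y ∈ rayClassField K (𝔣ψ * 𝔠r) → absClosureEmbedding K (v.adicCompletion K) y ∈ E)
    (h𝔠0 : 𝔣ψ * 𝔠r ≠ ⊥) (hv𝔠 : ¬ 𝔣ψ * 𝔠r ≤ v.asIdeal)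
    {𝔑 : Ideal (𝓞 K)} (h𝔑 : 𝔑 ≠ ⊥) (hv𝔑 : ¬ 𝔑 ≤ v.asIdeal)
    {α : 𝓞 K} (hα0 : α ≠ 0) (hα𝔑 : α - 1 ∈ 𝔑) (hαw : ∀ w : HeightOneSpectrum (𝓞 K), w ≠ v → α ∉ w.asIdeal)
    {f : ℕ} (hαπ : ((α : K) : v.adicCompletion K) =
      ((((u : 𝒪[v.adicCompletion K]) * ((2 : ℕ) : 𝒪[v.adicCompletion K]) : 𝒪[v.adicCompletion K]) : v.adicCompletion K)) ^ f)
    (hdegE : ∀ w : WeilGroup (v.adicCompletion K),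
      WeilGroup.toAbsGalois (v.adicCompletion K) w ∈ E.fixingSubgroup → (f : ℤ) ∣ WeilGroup.deg w)
    -- the two readings `θ`, `ι_p` conjugate through `τ_K ∈ Γ_K` (Q-θ); `w₀ : K → ℂ`
    (θ : CompletedAlgClosure (v.adicCompletion K) →+* ℂ_[2]) (ιp : PadicAlgCl 2 ≃+* ℂ) (w₀ : InfinitePlace K) {τK : absoluteGaloisGroup K}
    (hτK : ∀ x : AlgebraicClosure K,
      θ (algClosureToC (v.adicCompletion K) (absClosureEmbedding K (v.adicCompletion K) (τK • x))) =
        algebraMap (PadicAlgCl 2) ℂ_[2] (ιp.symm (algClosureEmb w₀.embedding x)))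
    -- the split prime `v = (π₀)`, `2 = π₀π₁`, `π₀ + π₁ = 1`; `π₀ = u·2` read `2`-adically is `c`; `ι(π₀)² = ι(π₀) − 2`
    {π₀ π₁ βK : 𝓞 K} (hv0 : v.asIdeal = Ideal.span {π₀}) (h2K : (2 : 𝓞 K) = π₀ * π₁) (htr : π₀ + π₁ = 1) (hprime : Prime π₀)
    (hπ₁ : ¬ π₀ ∣ π₁) (hc : padicEquivOfDegreeOne K 2 v he hf (algebraMap K (v.adicCompletion K) (π₀ : K)) = c)
    (hw : w₀.embedding (π₀ : K) ^ 2 = w₀.embedding (π₀ : K) - 2)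
    -- the modulus `𝔪 ≤ (π₁³)` of the units (`π₁` prime), the reading conductor `𝔠r ≤ 𝔪` with `β_K π₀ ≡ 1 (mod 𝔠r)`, `𝔑 ≤ 𝔣ψ·𝔪·(π₁)`
    {𝔪 : Ideal (𝓞 K)} (h𝔪1 : 𝔪 ≠ ⊤) (hprime₁ : Prime π₁) (h𝔪π₁ : 𝔪 ≤ Ideal.span {π₁ ^ 3}) (h𝔠𝔪 : 𝔠r ≤ 𝔪)
    (hβK : βK * π₀ - 1 ∈ 𝔠r)
    (h𝔑ψ : 𝔑 ≤ 𝔣ψ * (𝔪 * Ideal.span {π₁}))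
    -- the units `β_i ∈ 𝒰_E` reading the theta values `Θ(1; 𝔪v^{m+1}, 𝔞_i)`, `𝔠r ≤ 𝔞_i`
    {J : Type*} (β : J → RelNormCoherentUnits (isUniformizer_unit_mul h2 u) E) (𝔞 : J → Ideal (𝓞 K)) (h𝔠𝔞 : ∀ i, 𝔠r ≤ 𝔞 i)
    (xf : J → ∀ m : ℕ, rayClassField K (𝔪 * v.asIdeal ^ (m + 1)))
    (hxf : ∀ i m, IsThetaValueOne w₀.embedding (𝔪 * v.asIdeal ^ (m + 1)) (𝔞 i)
      (algClosureEmb w₀.embedding ((xf i m : rayClassField K (𝔪 * v.asIdeal ^ (m + 1))) : AlgebraicClosure K)))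
    (hβv : ∀ (i : J) (m : ℕ), (((((β i).val m : unitBall (E ⊔ ltField ((u : 𝒪[v.adicCompletion K]) * ((2 : ℕ) : 𝒪[v.adicCompletion K])) m :
        IntermediateField (v.adicCompletion K) (AlgebraicClosure (v.adicCompletion K)))) :
        (E ⊔ ltField ((u : 𝒪[v.adicCompletion K]) * ((2 : ℕ) : 𝒪[v.adicCompletion K])) m :
          IntermediateField (v.adicCompletion K) (AlgebraicClosure (v.adicCompletion K)))) : AlgebraicClosure (v.adicCompletion K))) =
      (absClosureEmbedding K (v.adicCompletion K)).toRingHom ((xf i m : rayClassField K (𝔪 * v.asIdeal ^ (m + 1))) : AlgebraicClosure K))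
    -- the model lattice `L = Ω·ι(𝔪)` of `W ⊗ ℂ`, `L′_i = 𝔞_i⁻¹L` with representatives `S_i`, a `v̄`-division point `ub`, `2Ω, 2π₀Ω ∉ L`
    (L : PeriodPair) (La : J → PeriodPair) (S : J → Finset ℂ) {Ω : ℂ} (hS : ∀ i, L.IsLatticeReps (La i) (S i))
    (hLa : ∀ i, (La i).lattice = idealInvLattice w₀.embedding (𝔞 i) L.lattice)
    (hL : ∀ z : ℂ, z ∈ L.lattice ↔ ∃ a ∈ 𝔪, z = Ω * w₀.embedding (a : K)) (hΩ : Ω ≠ 0)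
    (h₂ : L.g₂ = (W.baseChange ℂ).c₄ / 12) (h₃ : L.g₃ = (W.baseChange ℂ).c₆ / 216)
    {ub : ℂ} (hub1 : w₀.embedding (π₁ : K) * ub ∈ L.lattice) (hub0 : ub ∉ L.lattice)
    (h2Ω : (2 : ℂ) * Ω ∉ L.lattice) (h2Ω₁ : (2 : ℂ) * (w₀.embedding (π₀ : K) * Ω) ∉ L.lattice)
    -- the Grössencharacter `ψ` with `ψ(v) = π₀`, clause (vi) of II.1.5 at every `𝔠`, an ideal `𝔟` with `τ_K⁻¹|_{K(𝔣ψ𝔠r)} = (𝔟, ·)`,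
    -- clause (vii) at `𝔟`, `v`, `𝔟v` (level `K(𝔣ψ𝔠r)`), an inverse `δ` of `ψ𝔟` modulo `𝔠r`, `ψ(𝔟)Ω, ψ(𝔟v)Ω ∉ L′_i`
    (ψK : Ideal (𝓞 K) → 𝓞 K) (hψv : ψK v.asIdeal = π₀)
    (h6 : ∀ 𝔠 : Ideal (𝓞 K), 𝔠 ≠ ⊥ → ∀ z : ℂ, z ∈ idealInvLattice w₀.embedding 𝔠 L.lattice → z ∉ L.lattice →
      ∃ x y : rayClassField K (𝔣ψ * 𝔠), algClosureEmb w₀.embedding x = ℘[L] z ∧ algClosureEmb w₀.embedding y = ℘'[L] z)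
    {𝔟 : Ideal (𝓞 K)} (h𝔟0 : 𝔟 ≠ ⊥)
    (hg : absRestrictNormalHom (rayClassField K (𝔣ψ * 𝔠r)) τK⁻¹ = artinSymbol (galFrob K (rayClassField K (𝔣ψ * 𝔠r))) 𝔟)
    (hvii : ∀ 𝔟' ∈ ({𝔟, v.asIdeal, 𝔟 * v.asIdeal} : Set (Ideal (𝓞 K))), ∀ z : ℂ, z ∈ idealInvLattice w₀.embedding 𝔠r L.lattice →
      z ∉ L.lattice → ∀ x y : rayClassField K (𝔣ψ * 𝔠r), algClosureEmb w₀.embedding x = ℘[L] z → algClosureEmb w₀.embedding y = ℘'[L] z →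
        algClosureEmb w₀.embedding (artinSymbol (galFrob K (rayClassField K (𝔣ψ * 𝔠r))) 𝔟' x) = ℘[L] (w₀.embedding (ψK 𝔟' : K) * z) ∧
        algClosureEmb w₀.embedding (artinSymbol (galFrob K (rayClassField K (𝔣ψ * 𝔠r))) 𝔟' y) = ℘'[L] (w₀.embedding (ψK 𝔟' : K) * z))
    {δ : 𝓞 K} (hδ : δ * ψK 𝔟 - 1 ∈ 𝔠r)
    (hΩb : ∀ i, w₀.embedding (ψK 𝔟 : K) * Ω ∉ (La i).lattice)
    (hΩb' : ∀ i, w₀.embedding (ψK (𝔟 * v.asIdeal) : K) * Ω ∉ (La i).lattice)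
    -- the algebraic theta data at the reading level `K(𝔣ψ𝔠r)`: model coordinates of `ξ(Ω)`, `ξ(π₀Ω)`, `ξ(c)` (`c ∈ S_i ∖ 0`), the theta
    -- constants `K_i ∈ K`, with their `𝔓`-integrality / unit statements (de Shalit II.4.9 (i), hypotheses)
    (X₀ Y₀ X₁ Y₁ : rayClassField K (𝔣ψ * 𝔠r))
    (hX₀ : algClosureEmb w₀.embedding X₀ = ℘[L] Ω - (W.baseChange ℂ).b₂ / 12)
    (hY₀ : algClosureEmb w₀.embedding Y₀ = (℘'[L] Ω - (W.baseChange ℂ).a₁ * (℘[L] Ω - (W.baseChange ℂ).b₂ / 12) - (W.baseChange ℂ).a₃) / 2)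
    (hX₁ : algClosureEmb w₀.embedding X₁ = ℘[L] (w₀.embedding (π₀ : K) * Ω) - (W.baseChange ℂ).b₂ / 12)
    (hY₁ : algClosureEmb w₀.embedding Y₁ = (℘'[L] (w₀.embedding (π₀ : K) * Ω) -
      (W.baseChange ℂ).a₁ * (℘[L] (w₀.embedding (π₀ : K) * Ω) - (W.baseChange ℂ).b₂ / 12) - (W.baseChange ℂ).a₃) / 2)
    (hX₀i : X₀ ∈ readingRing E hEr) (hY₀i : Y₀ ∈ readingRing E hEr) (hX₁i : X₁ ∈ readingRing E hEr) (hY₁i : Y₁ ∈ readingRing E hEr)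
    (KcK : J → K) (hKcK : ∀ i, w₀.embedding (KcK i) = L.deltaRatio (La i) * (L.g₂ ^ 3 - 27 * L.g₃ ^ 2) ^ ((S i).card - 1))
    (hKci : ∀ i, algebraMap K (v.adicCompletion K) (KcK i) ∈ 𝒪[v.adicCompletion K])
    (Xc : J → ℂ → rayClassField K (𝔣ψ * 𝔠r))
    (hXc : ∀ i, ∀ c' ∈ (S i).erase 0, algClosureEmb w₀.embedding (Xc i c') = ℘[L] c' - (W.baseChange ℂ).b₂ / 12)
    (hXci : ∀ i c', Xc i c' ∈ readingRing E hEr)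
    (hXcu : ∀ i, ∀ c' ∈ (S i).erase 0, ‖(readingFieldHom E hEr (X₀ - Xc i c') : E)‖ = 1) :
    ∃ (xu yu : ℕ → AlgebraicClosure K)
      (XU YU : ∀ m : ℕ, ↥(E ⊔ ltField ((u : 𝒪[v.adicCompletion K]) * ((2 : ℕ) : 𝒪[v.adicCompletion K])) m :
        IntermediateField (v.adicCompletion K) (AlgebraicClosure (v.adicCompletion K))))
      (a : 𝒪[v.adicCompletion K]ˣ),
      -- the read division points `ξ(u_{m+1})`, `u_{m+1} = β_K^{m+1}Ω − Ω/π₀^{m+1}`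
      (∀ m : ℕ, algClosureEmb w₀.embedding (xu m) =
        ℘[L] (w₀.embedding ((βK ^ (m + 1) : 𝓞 K) : K) * Ω - Ω / w₀.embedding ((π₀ ^ (m + 1) : 𝓞 K) : K)) - (W.baseChange ℂ).b₂ / 12) ∧
      (∀ m : ℕ, algClosureEmb w₀.embedding (yu m) =
        (℘'[L] (w₀.embedding ((βK ^ (m + 1) : 𝓞 K) : K) * Ω - Ω / w₀.embedding ((π₀ ^ (m + 1) : 𝓞 K) : K)) -
          (W.baseChange ℂ).a₁ * (℘[L] (w₀.embedding ((βK ^ (m + 1) : 𝓞 K) : K) * Ω - Ω / w₀.embedding ((π₀ ^ (m + 1) : 𝓞 K) : K)) -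
            (W.baseChange ℂ).b₂ / 12) - (W.baseChange ℂ).a₃) / 2) ∧
      (∀ m, ((XU m : ↥(E ⊔ ltField ((u : 𝒪[v.adicCompletion K]) * ((2 : ℕ) : 𝒪[v.adicCompletion K])) m :
          IntermediateField (v.adicCompletion K) (AlgebraicClosure (v.adicCompletion K)))) : AlgebraicClosure (v.adicCompletion K)) =
        (absClosureEmbedding K (v.adicCompletion K)).toRingHom (xu m)) ∧
      (∀ m, ((YU m : ↥(E ⊔ ltField ((u : 𝒪[v.adicCompletion K]) * ((2 : ℕ) : 𝒪[v.adicCompletion K])) m :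
          IntermediateField (v.adicCompletion K) (AlgebraicClosure (v.adicCompletion K)))) : AlgebraicClosure (v.adicCompletion K)) =
        (absClosureEmbedding K (v.adicCompletion K)).toRingHom (yu m)) ∧
      -- B10a's point property of the Tate unit `a`
      (∀ (m : ℕ) (h : (curveOver (E ⊔ ltField ((u : 𝒪[v.adicCompletion K]) * ((2 : ℕ) : 𝒪[v.adicCompletion K])) m :
            IntermediateField (v.adicCompletion K) (AlgebraicClosure (v.adicCompletion K)))
          ((W.map (Int.castRingHom ℤ_[2])).map ((LTCoeff.of (v.adicCompletion K)).toRingHom.comp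
            ((integerEquivAdicCompletionIntegers v).trans (padicIntEquivOfDegreeOne K 2 v he hf)).symm.toRingHom))).toAffine.Nonsingular
          (XU m) (YU m)),
        ptOfZ (E ⊔ ltField ((u : 𝒪[v.adicCompletion K]) * ((2 : ℕ) : 𝒪[v.adicCompletion K])) m :
            IntermediateField (v.adicCompletion K) (AlgebraicClosure (v.adicCompletion K)))
            ((W.map (Int.castRingHom ℤ_[2])).map ((LTCoeff.of (v.adicCompletion K)).toRingHom.comp
              ((integerEquivAdicCompletionIntegers v).trans (padicIntEquivOfDegreeOne K 2 v he hf)).symm.toRingHom))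
            (evalPt₁ (maxNilIdeal (v.adicCompletion K) (E ⊔ ltField ((u : 𝒪[v.adicCompletion K]) * ((2 : ℕ) : 𝒪[v.adicCompletion K])) m :
                IntermediateField (v.adicCompletion K) (AlgebraicClosure (v.adicCompletion K))))
              (hom (isLTRing_LTCoeff (isUniformizer_unit_mul h2 u))
                (isLTSeries_map_LTCoeff_of_degree_one ((integerEquivAdicCompletionIntegers v).trans (padicIntEquivOfDegreeOne K 2 v he hf))
                  hq heπ hPlt) (isLTSeries_LTCoeff _) 1)
              (constantCoeff_hom _ _ _ 1)
              (evalPt₁ (maxNilIdeal (v.adicCompletion K) (E ⊔ ltField ((u : 𝒪[v.adicCompletion K]) * ((2 : ℕ) : 𝒪[v.adicCompletion K])) m :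
                  IntermediateField (v.adicCompletion K) (AlgebraicClosure (v.adicCompletion K))))
                (hom (isLTRing_LTCoeff (isUniformizer_unit_mul h2 u)) (isLTSeries_LTCoeff _) (isLTSeries_LTCoeff _)
                  (LTCoeff.of (v.adicCompletion K) (a : 𝒪[v.adicCompletion K])))
                (constantCoeff_hom _ _ _ _)
                (inclPt (le_sup_right : ltField ((u : 𝒪[v.adicCompletion K]) * ((2 : ℕ) : 𝒪[v.adicCompletion K])) m ≤
                    E ⊔ ltField ((u : 𝒪[v.adicCompletion K]) * ((2 : ℕ) : 𝒪[v.adicCompletion K])) m)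
                  (cohPt (isUniformizer_unit_mul h2 u) m)))) =
          (.some (XU m) (YU m) h : (curveOver (E ⊔ ltField ((u : 𝒪[v.adicCompletion K]) * ((2 : ℕ) : 𝒪[v.adicCompletion K])) m :
              IntermediateField (v.adicCompletion K) (AlgebraicClosure (v.adicCompletion K)))
            ((W.map (Int.castRingHom ℤ_[2])).map ((LTCoeff.of (v.adicCompletion K)).toRingHom.comp
              ((integerEquivAdicCompletionIntegers v).trans (padicIntEquivOfDegreeOne K 2 v he hf)).symm.toRingHom))).toAffine.Point)) ∧
      -- the values
      ∀ (i : J) (k : ℕ),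
        (θ.comp ((CBall (v.adicCompletion K)).subtype.comp (unitBallToCBall E)))
            (PowerSeries.constantCoeff ((fun g : PowerSeries (unitBall E) =>
              (invDiff (isLTRing_LTCoeff (isUniformizer_unit_mul h2 u))
                  (isLTSeries_LTCoeff ((u : 𝒪[v.adicCompletion K]) * ((2 : ℕ) : 𝒪[v.adicCompletion K])))).map
                  (algebraMap (LTCoeff (v.adicCompletion K)) (unitBall E)) *
                PowerSeries.derivative (unitBall E) g)^[k] (relLogDerivSeries (isUniformizer_unit_mul h2 u) E hq hEu hσ₀ (β i)))) =
          (θ (algebraMap (v.adicCompletion K) (CompletedAlgClosure (v.adicCompletion K)) ((a : 𝒪[v.adicCompletion K]) : v.adicCompletion K))) ^ (k + 1) *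
            ((ιp.symm (-12 * (((S i).card : ℂ) * L.eisensteinE (k + 1) (w₀.embedding (ψK 𝔟 : K) * Ω) -
              (La i).eisensteinE (k + 1) (w₀.embedding (ψK 𝔟 : K) * Ω))) : PadicAlgCl 2) : ℂ_[2]) ∧
        (θ.comp ((CBall (v.adicCompletion K)).subtype.comp (unitBallToCBall E)))
            ((frobUnitBall E σ₀ : unitBall E →+* unitBall E) (PowerSeries.constantCoeff ((fun g : PowerSeries (unitBall E) =>
              (invDiff (isLTRing_LTCoeff (isUniformizer_unit_mul h2 u))
                  (isLTSeries_LTCoeff ((u : 𝒪[v.adicCompletion K]) * ((2 : ℕ) : 𝒪[v.adicCompletion K])))).map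
                  (algebraMap (LTCoeff (v.adicCompletion K)) (unitBall E)) *
                PowerSeries.derivative (unitBall E) g)^[k] (relLogDerivSeries (isUniformizer_unit_mul h2 u) E hq hEu hσ₀ (β i))))) =
          (θ (algebraMap (v.adicCompletion K) (CompletedAlgClosure (v.adicCompletion K)) ((a : 𝒪[v.adicCompletion K]) : v.adicCompletion K))) ^ (k + 1) *
            ((ιp.symm (-12 * (((S i).card : ℂ) * L.eisensteinE (k + 1) (w₀.embedding (ψK (𝔟 * v.asIdeal) : K) * Ω) -
              (La i).eisensteinE (k + 1) (w₀.embedding (ψK (𝔟 * v.asIdeal) : K) * Ω))) : PadicAlgCl 2) : ℂ_[2]) := by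
  -- ### bookkeeping
  have h𝔠r0 : 𝔠r ≠ ⊥ := fun h ↦ h𝔠0 (by rw [h, Ideal.mul_bot])
  have hΛ : IsCMLattice w₀.embedding L.lattice := isCMLattice_of_model w₀.embedding hL
  have hΩL : Ω ∉ L.lattice := notMem_lattice_of_model w₀.embedding hL hΩ h𝔪1
  have hπ₀𝔪 : ∀ k : ℕ, (π₀ ^ k : 𝓞 K) ∉ 𝔪 := pow_notMem_of_le_span_pow hprime₁ htr (n := 3) (by norm_num) h𝔪π₁
  have hπΩL : w₀.embedding (π₀ : K) * Ω ∉ L.lattice := mul_gen_notMem w₀.embedding hL hΩ (by simpa using hπ₀𝔪 1)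
  have hΩ𝔠 : Ω ∈ idealInvLattice w₀.embedding 𝔠r L.lattice :=
    mem_idealInvLattice_iff.mpr fun t ht ↦ mem_idealInvLattice_iff.mp (mem_idealInvLattice_of_model w₀.embedding hL) t (h𝔠𝔪 ht)
  -- clause (vi)/(vii) at the reading conductor
  have hvi := h6 𝔠r h𝔠r0
  have hviiv := hvii v.asIdeal (by simp)
  -- ### the theta datum over `R = 𝒪_{F,(𝔓)}` ((RP), cf2-p1-w7 g16)
  obtain ⟨x₀, y₀, x₁, y₁, αR, Kc, x, uc, eι, hψj, hu, hKj, hxj, hx₀, hy₀, hx₁, hy₁, hαj, hτ, hKτ, heT, hinj, hsurj, hxτ, hτx₀, hτy₀⟩ :=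
    exists_thetaDatum_readingRing w₀.embedding E hEr h𝔠0 hv𝔠 hσ₀ W hW hβK ψK hψv h𝔪1 h𝔠𝔪 𝔞 h𝔠𝔞 L La S hS hLa hL hΩ hvi hviiv
      X₀ Y₀ X₁ Y₁ hX₀ hY₀ hX₁ hY₁ hX₀i hY₀i hX₁i hY₁i KcK hKcK hKci Xc hXc hXci hXcu
  -- ### the CM datum over `R` ((A), cf2-p1-w7 g16)
  obtain ⟨T, Pr, Qr, hT0, hTP, -, hT, hQC, hs, hQr, hPr, hidX, hidY⟩ :=
    exists_cmDatum_readingRing he hf w₀.embedding E hEr hPexp W hW hc hw L h₂ h₃ hΩL hπΩL h2Ω h2Ω₁ x₀ y₀ x₁ y₁ αR hx₀ hy₀ hx₁ hy₁ hαj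
  -- `hT`, `hQC` in B10f-e's shape (the multiplier `ι(π₀)`)
  -- ### the bridge with the Tate unit exposed (B10f-e (2), cf2c-w4 g16)
  obtain ⟨xu, yu, XU, YU, a, hxu, hyu, hXU, hYU, ha, hβ⟩ :=
    exists_tateUnit_forall_relColemanSeries_eq_subst_subst_of_lane_of_le_span_cube
      ((integerEquivAdicCompletionIntegers v).trans (padicIntEquivOfDegreeOne K 2 v he hf)) hq (isUniformizer_unit_mul h2 u) heπ hA hPlt
      W hW hV hp hϖ E hEu hσ₀ w₀.embedding h𝔪1 β 𝔞 xf hxf hβv hv0 h2K htr hprime hπ₁ hprime₁ h𝔪π₁ (h𝔠𝔪 hβK)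
      L La S hS hLa hL hΩ h₂ h₃ hub1 hub0 (readingHom E hEr)
      ((algebraMap (rayClassField K (𝔣ψ * 𝔠r)) (AlgebraicClosure K)).comp (readingRing E hEr).subtype) hψj x₀ y₀ x₁ y₁ αR Kc x uc hu
      hKj hxj hx₀ hy₀ hx₁ hy₁ hαj _ hτ hKτ eι heT hinj hsurj hxτ hτx₀ hτy₀ hT0 hTP hT hQC hs hQr hPr hidX hidY h6 h𝔑 hv𝔑 h𝔑ψ hα0 hα𝔑
      hαw hαπ hdegE
  refine ⟨xu, yu, XU, YU, a, hxu, hyu, hXU, hYU, ha, ?_⟩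
  -- ### the values (V1-label-core, cf2-p1-w8 g13)
  -- the `ℤ₂`-datum in V1's shape
  have hP' : P.map PadicInt.Coe.ringHom = ((W.map (Int.castRingHom ℤ_[2])).map PadicInt.Coe.ringHom).formalExp.subst
      (C (c : ℚ_[2]) * ((W.map (Int.castRingHom ℤ_[2])).map PadicInt.Coe.ringHom).formalLog) := by
    rw [hW, cm7Model_map]; exact hPexp
  -- the algebraic reading `j = (K(𝔣ψ𝔠r) ⊂ K̄) ∘ subtype`: injective, lands in `K(𝔣ψ𝔠r)`, reads `σ̃_v` on the Frobenius of `R`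
  have hjinj : Function.Injective ((algebraMap (rayClassField K (𝔣ψ * 𝔠r)) (AlgebraicClosure K)).comp (readingRing E hEr).subtype) :=
    (algebraMap (rayClassField K (𝔣ψ * 𝔠r)) (AlgebraicClosure K)).injective.comp Subtype.val_injective
  have hjmem : ∀ r : readingRing E hEr,
      ((algebraMap (rayClassField K (𝔣ψ * 𝔠r)) (AlgebraicClosure K)).comp (readingRing E hEr).subtype) r ∈ rayClassField K (𝔣ψ * 𝔠r) :=
    fun r ↦ (r : rayClassField K (𝔣ψ * 𝔠r)).2
  have hτ' : (frobUnitBall E σ₀ : unitBall E →+* unitBall E).comp (readingHom E hEr) =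
      (readingHom E hEr).comp (readingFrob E hEr h𝔠0 hv𝔠 : readingRing E hEr →+* readingRing E hEr) :=
    frobUnitBall_comp_readingHom E hEr h𝔠0 hv𝔠 hσ₀
  have hjτ' : ∀ r : readingRing E hEr,
      ((algebraMap (rayClassField K (𝔣ψ * 𝔠r)) (AlgebraicClosure K)).comp (readingRing E hEr).subtype)
          ((readingFrob E hEr h𝔠0 hv𝔠 : readingRing E hEr →+* readingRing E hEr) r) =
        absGaloisRestrict K (v.adicCompletion K) σ₀ •
          ((algebraMap (rayClassField K (𝔣ψ * 𝔠r)) (AlgebraicClosure K)).comp (readingRing E hEr).subtype) r := fun r ↦ by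
    change (((readingFrob E hEr h𝔠0 hv𝔠 r : readingRing E hEr) : rayClassField K (𝔣ψ * 𝔠r)) : AlgebraicClosure K) =
      absGaloisRestrict K (v.adicCompletion K) σ₀ • (((r : rayClassField K (𝔣ψ * 𝔠r))) : AlgebraicClosure K)
    rw [coe_readingFrob, absGaloisRestrict_smul_coe_rayClassField_eq_galFrob h𝔠0 hv𝔠 hσ₀]
  -- the theta constants are rational over `K`
  have hKc : ∀ i, ((algebraMap (rayClassField K (𝔣ψ * 𝔠r)) (AlgebraicClosure K)).comp (readingRing E hEr).subtype) (Kc i) =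
      algebraMap K (AlgebraicClosure K) (KcK i) := fun i ↦
    (algClosureEmb w₀.embedding).injective (by rw [hKj i, algClosureEmb_algebraMap, hKcK i])
  have hβK' : βK * ψK v.asIdeal - 1 ∈ 𝔠r := by rw [hψv]; exact hβK
  exact forall_readingHom_moment_and_frob_eq_of_bridgeFamily_of_readings (_hA := hA) v he hf hq h2 u E hEu hσ₀ θ ιp w₀ hτK W hP' hPlt
    heπ (readingHom E hEr) ((algebraMap (rayClassField K (𝔣ψ * 𝔠r)) (AlgebraicClosure K)).comp (readingRing E hEr).subtype) hjinj
    (fun r ↦ hψj r) h𝔠0 hv𝔠 hjmem _ hτ' hjτ' L hΛ h₂ h₃ hΩ𝔠 hΩL 𝔞 h𝔠𝔞 La S hS hLa x₀ y₀ Kc KcK x uc hu hKc hKj hxj hx₀ hy₀ β a hβ ψK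
    h𝔟0 hvi hg hvii hδ hβK' hΩb hΩb'

end Summit.BirchSwinnertonDyer.BirchSwinnertonDyer.Theorems.PrintCf2.KatzMeasureJZeroSeam

end
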